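import Summits.KontsevichZagierPeriods.KontsevichZagierPeriods.Theorems.RootDecompRationalCubeDichotomyNashMultiGenP09

/-! # `RootDecompRationalCubeDichotomyNashMultiGenP10` — part 10/16 of the mechanical ≤385-line split of `NashEtaleMultiGen.lean`
(split by the decomp-kz census seat for landing; mathematics unchanged; part 10 continues part 9). -/

open Set MvPolynomial Filter Topology
open Literature.NumberTheory.Transcendental (IsSemialgebraicFunOn)
open Literature.ModelTheory.ExponentialFields (IsSemialgebraic isSemialgebraic_setOf_eval_pos
  isSemialgebraic_setOf_eval_ne_zero)

namespace Summit.KontsevichZagierPeriods.RootDecompRationalCubeDichotomy.Rung29430.MultiGen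
open Summit.KontsevichZagierPeriods.KontsevichZagierPeriods.Theses.RootDecompRationalCubeDichotomy
  (NashEtaleCover NashEtaleLocal PiRationalisation)
open Summit.KontsevichZagierPeriods.RootDecompRationalCubeDichotomy.Rung29430.NashEtaleLocalGlue
  (local_of_simple nashEtaleCover_of_nashEtaleLocal nashEtaleLocal_zero)
open Summit.KontsevichZagierPeriods.RootDecompRationalCubeDichotomy.Rung29430.NashEtaleLocalOne
  (analyticOnNhd_aeval_snoc)
open Summit.KontsevichZagierPeriods.RootDecompRationalCubeDichotomy.RungEtale.Etale
  (piRationalisation_of_nashEtaleCover)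

noncomputable section

/-! ## §6  SPREADING OUT (v5): the generic identity principle, and piece M at product points
from `K`-Nash germs AT THE ORIGIN (no parameters)

At a product point `y₀ = (s₀, 0)` (`s₀ ∈ ℝᵐ` algebraically independent, `d ≥ 1` zero
coordinates) the slice germ `t ↦ g(s₀, t)` is a `K`-Nash germ at the ORIGIN of `ℝᵈ` for the
field `K = ℚ(s₀) ⊂ ℝ`.  Étale data for it over `K` SPREADS OUT to `ℚ`-étale data near `y₀`
(clear the denominators in `s₀`, run the `ℚ`-Nash implicit function theorem §4e), and the
resulting `g̃` agrees with `g` near `y₀` by the **generic identity principle**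
(`eventually_eq_zero_of_slice`): a `ℚ`-Nash function vanishing on the generic slice
`{s₀} × (nbhd of 0)` vanishes near `y₀`. -/

section Spread

/-- Continuity of `t ↦ (s₀, t)`. -/
theorem continuous_append_right {m d : ℕ} (s₀ : Fin m → ℝ) :
    Continuous (fun t : Fin d → ℝ => (Fin.append s₀ t : Fin (m + d) → ℝ)) := by
  refine continuous_pi fun l => ?_
  refine Fin.addCases (fun i => ?_) (fun j => ?_) l
  · simp only [Fin.append_left]
    exact continuous_const
  · simp only [Fin.append_right]
    exact continuous_apply j

/-- Analyticity of `t ↦ P(s₀, t)`. -/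
theorem analyticAt_aeval_append_right {m d : ℕ} (s₀ : Fin m → ℝ)
    (P : MvPolynomial (Fin (m + d)) ℚ) (t : Fin d → ℝ) :
    AnalyticAt ℝ (fun t : Fin d → ℝ => MvPolynomial.aeval (Fin.append s₀ t : Fin (m + d) → ℝ) P) t := by
  refine AnalyticAt.aeval_mvPolynomial (fun l => ?_) P
  refine Fin.addCases (fun i => ?_) (fun j => ?_) l
  · simp only [Fin.append_left]
    exact analyticAt_const
  · simp only [Fin.append_right]
    exact (ContinuousLinearMap.proj (R := ℝ) (φ := fun _ : Fin d => ℝ) j).analyticAt t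

/-- `evP y 0 q = (q.coeff 0)(y)`. -/
theorem evP_zero_eq_coeff {n : ℕ} (y : Fin n → ℝ) (q : Polynomial (PolyRing n)) :
    evP n y 0 q = MvPolynomial.aeval y (q.coeff 0) := by
  rw [evP_apply, Polynomial.eval₂_at_zero]
  rfl

/-- `evP y w q = w · evP y w (divX q) + (q.coeff 0)(y)`. -/
theorem evP_eq_mul_divX_add {n : ℕ} (y : Fin n → ℝ) (w : ℝ) (q : Polynomial (PolyRing n)) :
    evP n y w q = w * evP n y w q.divX + MvPolynomial.aeval y (q.coeff 0) := by
  conv_lhs => rw [← Polynomial.X_mul_divX_add q]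
  rw [map_add, map_mul, evP_X, evP_C]

/-- Substituting RATIONAL values for the last `d` variables: `θ_t`. -/
def substRat {m d : ℕ} (t : Fin d → ℚ) : Fin (m + d) → PolyRing m :=
  Fin.append (fun i => X i) (fun j => C (t j))

/-- Auxiliary step `aeval_bind₁_substRat`. [bookkeeping] -/
theorem aeval_bind₁_substRat {m d : ℕ} (t : Fin d → ℚ) (s : Fin m → ℝ) (c : PolyRing (m + d)) :
    MvPolynomial.aeval s (MvPolynomial.bind₁ (substRat (m := m) t) c) =
      MvPolynomial.aeval (Fin.append s (fun j => (t j : ℝ)) : Fin (m + d) → ℝ) c := by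
  have hfun : (fun i => MvPolynomial.aeval s (substRat (m := m) t i)) =
      (Fin.append s (fun j => (t j : ℝ)) : Fin (m + d) → ℝ) := by
    funext l
    refine Fin.addCases (fun i => ?_) (fun j => ?_) l
    · simp [substRat, Fin.append_left]
    · simp [substRat, Fin.append_right]
  rw [MvPolynomial.aeval_bind₁, hfun]

/-- A polynomial over `ℚ` vanishing at `(s₀, t)` for all `t` in a neighbourhood of `0`, with `s₀`
algebraically independent, vanishes at EVERY real point. -/
theorem aeval_eq_zero_of_slice {m d : ℕ} {s₀ : Fin m → ℝ} (hind : AlgebraicIndependent ℚ s₀)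
    (c : PolyRing (m + d))
    (hc : ∀ᶠ t in 𝓝 (0 : Fin d → ℝ), MvPolynomial.aeval (Fin.append s₀ t : Fin (m + d) → ℝ) c = 0)
    (y : Fin (m + d) → ℝ) : MvPolynomial.aeval y c = 0 := by
  classical
  -- (ii) analytic continuation in `t`: zero for ALL real `t`
  have hall : ∀ t : Fin d → ℝ, MvPolynomial.aeval (Fin.append s₀ t : Fin (m + d) → ℝ) c = 0 := by
    have han : AnalyticOnNhd ℝ
        (fun t : Fin d → ℝ => MvPolynomial.aeval (Fin.append s₀ t : Fin (m + d) → ℝ) c) Set.univ :=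
      fun t _ => analyticAt_aeval_append_right s₀ c t
    have h := han.eqOn_zero_of_preconnected_of_eventuallyEq_zero isPreconnected_univ
      (Set.mem_univ (0 : Fin d → ℝ)) hc
    intro t
    exact h (Set.mem_univ t)
  -- (iii) rational `t`: the specialised polynomial in `s` vanishes identically
  have hinj : Function.Injective (MvPolynomial.aeval s₀ : PolyRing m →ₐ[ℚ] ℝ) :=
    algebraicIndependent_iff_injective_aeval.mp hind
  have hrat : ∀ (t : Fin d → ℚ) (s : Fin m → ℝ),
      MvPolynomial.aeval (Fin.append s (fun j => (t j : ℝ)) : Fin (m + d) → ℝ) c = 0 := by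
    intro t s
    have h0 : MvPolynomial.bind₁ (substRat (m := m) t) c = 0 := by
      apply hinj
      rw [aeval_bind₁_substRat, map_zero]
      exact hall _
    rw [← aeval_bind₁_substRat, h0, map_zero]
  -- (iv) density of `ℚᵈ` in the last `d` coordinates
  let F : (Fin d → ℝ) → ℝ := fun t =>
    MvPolynomial.aeval (Fin.append (fun i => y (Fin.castAdd d i)) t : Fin (m + d) → ℝ) c
  have hFc : Continuous F := continuous_iff_continuousAt.2 fun t =>
    (analyticAt_aeval_append_right (fun i => y (Fin.castAdd d i)) c t).continuousAt
  have hdense : Dense (Set.pi Set.univ (fun _ : Fin d => Set.range ((↑) : ℚ → ℝ))) :=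
    dense_pi Set.univ fun _ _ => Rat.denseRange_cast
  have hFzero : F = fun _ => 0 := by
    refine Continuous.ext_on hdense hFc continuous_const fun t ht => ?_
    have ht' : ∀ j, ∃ qj : ℚ, (qj : ℝ) = t j := fun j => ht j (Set.mem_univ j)
    choose tq htq using ht'
    have : t = fun j => (tq j : ℝ) := funext fun j => (htq j).symm
    simp only [F, this]
    exact hrat tq _
  have hy : (Fin.append (fun i => y (Fin.castAdd d i)) (fun j => y (Fin.natAdd m j)) :
      Fin (m + d) → ℝ) = y := by
    funext l
    refine Fin.addCases (fun i => ?_) (fun j => ?_) l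
    · simp only [Fin.append_left]
    · simp only [Fin.append_right]
  have := congrFun hFzero (fun j => y (Fin.natAdd m j))
  simp only [F, hy] at this
  exact this

/-- **The generic identity principle.**  Let `s₀ ∈ ℝᵐ` be algebraically independent over `ℚ`
and `δ` a `ℚ`-Nash function near `y₀ = (s₀, 0) ∈ ℝᵐ⁺ᵈ`.  If `δ(s₀, t) = 0` for all `t` near
`0`, then `δ = 0` near `y₀`.  (Proof: minimal relation `q(y, δ) = 0` on a rational box; its
constant coefficient vanishes on the slice, hence everywhere (`aeval_eq_zero_of_slice`); so
`δ · q₁(y, δ) = 0` with `q₁ = q / w` of smaller degree, `q₁(y, δ y) ≢ 0` by minimality, and the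
identity theorem.) -/
theorem eventually_eq_zero_of_slice {m d : ℕ} {s₀ : Fin m → ℝ} (hind : AlgebraicIndependent ℚ s₀)
    {δ : (Fin (m + d) → ℝ) → ℝ} {U : Set (Fin (m + d) → ℝ)} (hU : IsOpen U)
    (hy₀ : (Fin.append s₀ (0 : Fin d → ℝ) : Fin (m + d) → ℝ) ∈ U)
    (hsa : IsSemialgebraicFunOn ℚ U δ) (han : AnalyticOnNhd ℝ δ U)
    (hslice : ∀ᶠ t in 𝓝 (0 : Fin d → ℝ), δ (Fin.append s₀ t) = 0) :
    ∀ᶠ y in 𝓝 (Fin.append s₀ (0 : Fin d → ℝ) : Fin (m + d) → ℝ), δ y = 0 := by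
  classical
  obtain ⟨a, b, hyS, hSU⟩ := exists_ratBox_subset hU hy₀
  have hSo : IsOpen (ratBox a b) := isOpen_ratBox a b
  have hSsa : IsSemialgebraicFunOn ℚ (ratBox a b) δ := hsa.mono hSU (isSemialgebraic_ratBox a b)
  have hSan : AnalyticOnNhd ℝ δ (ratBox a b) := han.mono hSU
  -- a relation of minimal degree on the box
  have hrel : ∃ e : ℕ, ∃ q : Polynomial (PolyRing (m + d)), q ≠ 0 ∧ q.natDegree = e ∧
      ∀ y ∈ ratBox a b, evP (m + d) y (δ y) q = 0 := by
    obtain ⟨q, hq0, hq⟩ := exists_relation_poly hSsa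
    exact ⟨_, q, hq0, rfl, hq⟩
  obtain ⟨q, hq0, hqe, hq⟩ := Nat.find_spec hrel
  have hmin : ∀ q' : Polynomial (PolyRing (m + d)), q' ≠ 0 →
      (∀ y ∈ ratBox a b, evP (m + d) y (δ y) q' = 0) → q.natDegree ≤ q'.natDegree := fun q' h0 h => by
    rw [hqe]
    exact Nat.find_min' hrel ⟨q', h0, rfl, h⟩
  -- the constant coefficient vanishes on the slice, hence at every real point
  have hslice' : ∀ᶠ t in 𝓝 (0 : Fin d → ℝ),
      MvPolynomial.aeval (Fin.append s₀ t : Fin (m + d) → ℝ) (q.coeff 0) = 0 := by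
    have hmem : ∀ᶠ t in 𝓝 (0 : Fin d → ℝ), (Fin.append s₀ t : Fin (m + d) → ℝ) ∈ ratBox a b :=
      (continuous_append_right s₀).continuousAt.preimage_mem_nhds (hSo.mem_nhds hyS)
    filter_upwards [hslice, hmem] with t ht hmt
    have := hq _ hmt
    rwa [ht, evP_zero_eq_coeff] at this
  have hc0 : ∀ y : Fin (m + d) → ℝ, MvPolynomial.aeval y (q.coeff 0) = 0 :=
    aeval_eq_zero_of_slice hind (q.coeff 0) hslice'
  -- `q₁ = divX q` is a non-zero polynomial of smaller degree with `δ · q₁(y, δ) = 0` on the box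
  have hq₁ : ∀ y ∈ ratBox a b, δ y * evP (m + d) y (δ y) q.divX = 0 := by
    intro y hy
    have := hq y hy
    rwa [evP_eq_mul_divX_add, hc0 y, add_zero] at this
  have hq₁0 : q.divX ≠ 0 := by
    intro h0
    rw [Polynomial.divX_eq_zero_iff] at h0
    have hcoef : q.coeff 0 = 0 := by
      apply MvPolynomial.map_injective (algebraMap ℚ ℝ) (algebraMap ℚ ℝ).injective
      rw [map_zero]
      apply MvPolynomial.funext
      intro y
      rw [MvPolynomial.eval_map, map_zero]
      exact hc0 y
    exact hq0 (by rw [h0, hcoef, map_zero])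
  have hdeg : q.divX.natDegree < q.natDegree := by
    rw [Polynomial.natDegree_divX_eq_natDegree_tsub_one]
    have : q.natDegree ≠ 0 := by
      intro h0
      obtain ⟨x, hx⟩ := Polynomial.natDegree_eq_zero.mp h0
      exact hq₁0 (by rw [← hx, Polynomial.divX_C])
    omega
  -- by minimality `q₁(y, δ y)` is not identically zero on the box
  have hne : ∃ y₁ ∈ ratBox a b, evP (m + d) y₁ (δ y₁) q.divX ≠ 0 := by
    by_contra hcon
    push Not at hcon
    exact absurd (hmin _ hq₁0 hcon) (not_le.mpr hdeg)
  obtain ⟨y₁, hy₁S, hy₁⟩ := hne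
  -- analytic conclusion
  have hκan : AnalyticOnNhd ℝ
      (fun y => MvPolynomial.aeval (Fin.snoc y (δ y) : Fin (m + d + 1) → ℝ) (fromPoly (m + d) q.divX))
      (ratBox a b) := analyticOnNhd_aeval_snoc hSan (fromPoly (m + d) q.divX)
  have hev : δ =ᶠ[𝓝 y₁] 0 := by
    have hκ1 : MvPolynomial.aeval (Fin.snoc y₁ (δ y₁) : Fin (m + d + 1) → ℝ)
        (fromPoly (m + d) q.divX) ≠ 0 := by rwa [aeval_snoc_fromPoly]
    filter_upwards [(hκan y₁ hy₁S).continuousAt.eventually_ne hκ1, hSo.mem_nhds hy₁S] with y hy hyS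
    rw [aeval_snoc_fromPoly] at hy
    exact (mul_eq_zero.mp (hq₁ y hyS)).resolve_right hy
  have hδS := hSan.eqOn_zero_of_preconnected_of_eventuallyEq_zero (isPreconnected_ratBox a b) hy₁S hev
  filter_upwards [hSo.mem_nhds hyS] with y hy
  exact hδS hy

end Spread

/-! ### §6.1  `K`-point data at the ORIGIN and the parameter-free residual `OriginNash d` -/

section OriginData

open Literature.NumberTheory.Transcendental Literature.ModelTheory.ExponentialFields

/-- **`K`-étale point data at the origin** for a germ `G` at `0 ∈ ℝᵈ`, over a coefficient ring
`K → ℝ`: polynomials `F₁..F_k, A, B ∈ K[t, y]` and a REAL point `y₀ ∈ ℝᵏ` with `F(0, y₀) = 0`,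
`det ∂F/∂y (0, y₀) ≠ 0`, `B(0, y₀) ≠ 0`, such that along EVERY analytic solution `u` of
`F(t, u(t)) = 0` through `y₀`, `G = A(t,u)/B(t,u)` near `0`.  (The `K`-analogue, at the origin,
of `PointDataAt`; `y₀` need not be `K`-rational — e.g. `G(t) = √2 + t` over `K = ℚ`.) -/
def OriginPointData (K : Type) [CommRing K] [Algebra K ℝ] (d : ℕ) (G : (Fin d → ℝ) → ℝ) : Prop :=
  ∃ (k : ℕ) (y₀ : Fin k → ℝ) (F : Fin k → MvPolynomial (Fin (d + k)) K)
    (A B : MvPolynomial (Fin (d + k)) K),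
    (∀ i, MvPolynomial.aeval (Fin.append (0 : Fin d → ℝ) y₀) (F i) = 0) ∧
    (Matrix.of fun i j : Fin k =>
      MvPolynomial.aeval (Fin.append (0 : Fin d → ℝ) y₀) (pderiv (Fin.natAdd d j) (F i))).det ≠ 0 ∧
    MvPolynomial.aeval (Fin.append (0 : Fin d → ℝ) y₀) B ≠ 0 ∧
    ∀ (V : Set (Fin d → ℝ)) (u : Fin k → (Fin d → ℝ) → ℝ), IsOpen V → (0 : Fin d → ℝ) ∈ V →
      (∀ j, u j 0 = y₀ j) → (∀ j, AnalyticOnNhd ℝ (u j) V) →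
      (∀ t ∈ V, ∀ i, MvPolynomial.aeval (Fin.append t fun j => u j t) (F i) = 0) →
      ∃ W ⊆ V, IsOpen W ∧ (0 : Fin d → ℝ) ∈ W ∧ ∀ t ∈ W,
        G t = MvPolynomial.aeval (Fin.append t fun j => u j t) A /
          MvPolynomial.aeval (Fin.append t fun j => u j t) B

/-- **The parameter-free residual `OriginNash d`** (v5): for EVERY coefficient ring `K → ℝ`,
every `K`-semialgebraic real-analytic germ at the origin of `ℝᵈ` has `K`-étale point data at the
origin.  [Informal content: the ring of `K`-Nash germs at `0 ∈ ℝᵈ` is a filtered union of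
étale `K[t]`-algebras with a real point over `t = 0` — Artin–Mazur / Nagata–Raynaud
"algebraic power series = henselisation" plus descent of the (finite) coefficient field; for a
non-field `K` clear denominators.  `d = 1`: the g7 Nagata-truncation proof of the `n = 1`
slice, run over `K` instead of `ℚ`.]  NO parameters, NO cube, ONE point. -/
def OriginNash (d : ℕ) : Prop :=
  ∀ (K : Type) [CommRing K] [Algebra K ℝ] (G : (Fin d → ℝ) → ℝ) (U : Set (Fin d → ℝ)),
    IsOpen U → (0 : Fin d → ℝ) ∈ U → IsSemialgebraicFunOn K U G → AnalyticOnNhd ℝ G U →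
    OriginPointData K d G

/-! ### §6.2  Base change `ℚ → K` of semialgebraic sets, and the slice germ over `K ∋ s₀` -/

/-- Auxiliary step `algebraMap_comp_rat`. [bookkeeping] -/
theorem algebraMap_comp_rat (K : Type*) [CommRing K] [Algebra ℚ K] [Algebra K ℝ] :
    (algebraMap K ℝ).comp (algebraMap ℚ K) = algebraMap ℚ ℝ :=
  RingHom.ext_rat _ _

/-- Auxiliary step `aeval_map_algebraMap_rat`. [bookkeeping] -/
theorem aeval_map_algebraMap_rat {K : Type*} [CommRing K] [Algebra ℚ K] [Algebra K ℝ] {ι : Type*}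
    (x : ι → ℝ) (p : MvPolynomial ι ℚ) :
    MvPolynomial.aeval x (MvPolynomial.map (algebraMap ℚ K) p) = MvPolynomial.aeval x p := by
  rw [MvPolynomial.aeval_def, MvPolynomial.eval₂_map, algebraMap_comp_rat, ← MvPolynomial.aeval_def]

/-- `ℚ`-semialgebraic sets are `K`-semialgebraic for every `ℚ`-algebra `K → ℝ`. -/
theorem isSemialgebraic_baseChange (K : Type*) [CommRing K] [Algebra ℚ K] [Algebra K ℝ]
    {ι : Type*} {s : Set (ι → ℝ)} (hs : IsSemialgebraic ℚ s) : IsSemialgebraic K s := by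
  induction hs using BooleanSubalgebra.closure_bot_sup_induction with
  | mem t ht =>
    rcases ht with ⟨p, rfl⟩ | ⟨p, rfl⟩
    · convert isSemialgebraic_setOf_eval_eq_zero (R := ℝ)
        (MvPolynomial.map (algebraMap ℚ K) p) using 1
      ext x
      simp only [Set.mem_setOf_eq, aeval_map_algebraMap_rat]
    · convert isSemialgebraic_setOf_eval_pos (R := ℝ)
        (MvPolynomial.map (algebraMap ℚ K) p) using 1
      ext x
      simp only [Set.mem_setOf_eq, aeval_map_algebraMap_rat]
  | bot => exact isSemialgebraic_empty
  | sup t _ u _ iht ihu => exact iht.union ihu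
  | compl t _ iht => exact iht.compl

/-- **The slice germ is `K`-semialgebraic.**  If `K → ℝ` contains elements `c i ↦ s₀ i`, the
slice `t ↦ g(s₀, t)` of a `ℚ`-semialgebraic `g` is `K`-semialgebraic (substitute the constants
`c i ∈ K` for the first `m` variables). -/
theorem isSemialgebraicFunOn_slice {m d : ℕ} {K : Type} [CommRing K] [Algebra ℚ K] [Algebra K ℝ]
    (c : Fin m → K) (s₀ : Fin m → ℝ) (hc : ∀ i, algebraMap K ℝ (c i) = s₀ i)
    {S : Set (Fin (m + d) → ℝ)} {g : (Fin (m + d) → ℝ) → ℝ} (hsa : IsSemialgebraicFunOn ℚ S g) :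
    IsSemialgebraicFunOn K
      ((fun t : Fin d → ℝ => (Fin.append s₀ t : Fin (m + d) → ℝ)) ⁻¹' S)
      (fun t => g (Fin.append s₀ t)) := by
  classical
  -- the substitution `(t, w) ↦ (c, t, w)` as a `K`-polynomial map
  let P : Fin (m + d + 1) → MvPolynomial (Fin (d + 1)) K :=
    Fin.snoc (Fin.append (fun i : Fin m => C (c i)) (fun j : Fin d => X (Fin.castSucc j)))
      (X (Fin.last d))
  have hP : ∀ z : Fin (d + 1) → ℝ, (fun l => MvPolynomial.aeval z (P l)) =
      Fin.snoc (Fin.append s₀ (Fin.init z) : Fin (m + d) → ℝ) (z (Fin.last d)) := by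
    intro z
    funext l
    refine Fin.lastCases ?_ (fun l' => ?_) l
    · simp [P]
    · simp only [P, Fin.snoc_castSucc]
      refine Fin.addCases (fun i => ?_) (fun j => ?_) l'
      · simp [Fin.append_left, hc]
      · simp [Fin.append_right, Fin.init]
  have hg' := isSemialgebraic_baseChange K (isSemialgebraicFunOn_iff.mp hsa)
  rw [isSemialgebraicFunOn_iff]
  convert hg'.preimage_aeval P using 1
  ext z
  simp only [Set.mem_setOf_eq, Set.mem_preimage, hP z, Fin.init_snoc, Fin.snoc_last]

/-- Analyticity of `t ↦ (s₀, t)`. -/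
theorem analyticAt_append_right {m d : ℕ} (s₀ : Fin m → ℝ) (t : Fin d → ℝ) :
    AnalyticAt ℝ (fun t : Fin d → ℝ => (Fin.append s₀ t : Fin (m + d) → ℝ)) t := by
  refine analyticAt_pi_iff.mpr fun l => ?_
  refine Fin.addCases (fun i => ?_) (fun j => ?_) l
  · simp only [Fin.append_left]
    exact analyticAt_const
  · simp only [Fin.append_right]
    exact (ContinuousLinearMap.proj (R := ℝ) (φ := fun _ : Fin d => ℝ) j).analyticAt t

/-! ### §6.3  SPREADING a `ℚ[s]`-polynomial in `(t, y)` to a `ℚ`-polynomial in `(s, t, y)` -/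

/-- `ℝ` as an algebra over the coefficient ring `ℚ[s₁..sₘ]` via `s ↦ s₀` (a `def`, used with
`letI`; never an instance). -/
@[reducible] def evalAlg {m : ℕ} (s₀ : Fin m → ℝ) : Algebra (PolyRing m) ℝ :=
  (MvPolynomial.aeval s₀ : PolyRing m →ₐ[ℚ] ℝ).toRingHom.toAlgebra

/-- coefficient variables `s_i ↦` position `i` of `(s, t, y)` -/
def ιc (m d k : ℕ) (i : Fin m) : Fin (m + d + k) := Fin.castAdd k (Fin.castAdd d i)

/-- variables `(t, y) ↦` positions of `(s, t, y)` -/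
def ιv (m d k : ℕ) : Fin (d + k) → Fin (m + d + k) :=
  Fin.append (fun j : Fin d => Fin.castAdd k (Fin.natAdd m j)) (fun r : Fin k => Fin.natAdd (m + d) r)

/-- Auxiliary step `apply_ιc`. [bookkeeping] -/
theorem apply_ιc {m d k : ℕ} (s : Fin m → ℝ) (t : Fin d → ℝ) (y : Fin k → ℝ) (i : Fin m) :
    (Fin.append (Fin.append s t) y : Fin (m + d + k) → ℝ) (ιc m d k i) = s i := by
  simp [ιc, Fin.append_left]

/-- Auxiliary step `apply_ιv`. [bookkeeping] -/
theorem apply_ιv {m d k : ℕ} (s : Fin m → ℝ) (t : Fin d → ℝ) (y : Fin k → ℝ) :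
    (fun l => (Fin.append (Fin.append s t) y : Fin (m + d + k) → ℝ) (ιv m d k l)) =
      (Fin.append t y : Fin (d + k) → ℝ) := by
  funext l
  refine Fin.addCases (fun j => ?_) (fun r => ?_) l
  · simp [ιv, Fin.append_left, Fin.append_right]
  · simp [ιv, Fin.append_right]

/-- Auxiliary step `ιc_ne_natAdd`. [bookkeeping] -/
theorem ιc_ne_natAdd {m d k : ℕ} (i : Fin m) (j : Fin k) : ιc m d k i ≠ Fin.natAdd (m + d) j := by
  intro h
  have := congrArg Fin.val h
  simp [ιc] at this
  omega

/-- Auxiliary step `ιv_eq_natAdd_iff`. [bookkeeping] -/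
theorem ιv_eq_natAdd_iff {m d k : ℕ} (l : Fin (d + k)) (j : Fin k) :
    ιv m d k l = Fin.natAdd (m + d) j ↔ l = Fin.natAdd d j := by
  refine Fin.addCases (fun j' => ?_) (fun r => ?_) l
  · simp only [ιv, Fin.append_left]
    constructor
    · intro h
      have := congrArg Fin.val h
      simp at this
      omega
    · intro h
      have := congrArg Fin.val h
      simp at this
      omega
  · simp only [ιv, Fin.append_right]
    constructor
    · intro h
      have := congrArg Fin.val h
      simp at this
      exact Fin.ext (by simp; omega)
    · intro h
      have := congrArg Fin.val h
      simp at this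
      exact Fin.ext (by simp; omega)

/-- The spreading map `ℚ[s][t, y] → ℚ[s, t, y]`. -/
def spread (m d k : ℕ) : MvPolynomial (Fin (d + k)) (PolyRing m) →ₐ[ℚ] MvPolynomial (Fin (m + d + k)) ℚ :=
  MvPolynomial.aevalTower (MvPolynomial.rename (ιc m d k) : PolyRing m →ₐ[ℚ] MvPolynomial (Fin (m + d + k)) ℚ)
    (fun l => X (ιv m d k l))

end OriginData
end
end Summit.KontsevichZagierPeriods.RootDecompRationalCubeDichotomy.Rung29430.MultiGen
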